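import Mathlib.Analysis.Convex.Basic
import Literature.NumberTheory.Automorphic.LanglandsCombinatorialLemma
import HarnessLib

/-!
# The convex sets `C(P, Q, R, X)` and the compact support of Arthur's functions `Γ_P^R(·, X)`
(Labesse–Waldspurger, Ch. 1, §1.8 "Cônes et convexes"; with Lemmes 1.2.4 and 1.2.10)

Topic `NumberTheory/Automorphic`; namespace `Literature.NumberTheory.Automorphic.ObtuseBasis`
(continuation of `LanglandsCombinatorialLemma.lean`, same setting and dictionary: `V` a real
inner product space, `α : ι → V` an obtuse family with linearly independent finite sub-families,
`ϖ` a system of dual families, finite index sets `J = Δ_0^P ⊆ L = Δ_0^Q ⊆ K = Δ_0^R` standing for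
standard parabolic subgroups `P ⊂ Q ⊂ R`, `W_K = spanOn α K = 𝔞_0^R`, `π_J = proj α ϖ J` the
orthogonal projection onto `W_J`, `a_k(H) = ⟪α k, H - π_J H⟫` the values of the relative roots
`Δ_P^R` and `⟪ϖ K k, H⟫` those of the relative weights `Δ̂_P^R`, `k ∈ K ∖ J`).

This file formalizes the part of Labesse–Waldspurger, *La formule des traces tordue d'après le
Friday Morning Seminar* (CRM Monograph Series 31, 2013 = arXiv:1204.2888), Ch. 1, that makes
Arthur's truncation produce *polynomials in the truncation parameter*: the functions
`Γ_P^R(H, X) = ∑_{P ⊂ Q ⊂ R} (-1)^{a_Q - a_R} τ_P^Q(H) τ̂_Q^R(H - X)` (Arthur, *The trace formula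
in invariant form*, Ann. of Math. 114 (1981), §2; Labesse–Waldspurger §1.8) and the fact that
`H ↦ Γ_P^R(H, X)` has a support whose projection to `𝔞_P^R` is compact, of size linear in `X`
(loc. cit., Lemme 1.8.3; Arthur 1981, Lemma 2.1 — cf. Shokranian, LNM 1503, Lemma 5.4: "if `H`
is restricted to `𝔞_P^G`, then `Γ_P(H, X)` is compactly supported in `H` … Proof. [Arthur 1981]
Lemmas 2.1 and 2.2").

## Main definitions

* `relProj α ϖ J K H = π_K H - π_J H` — the component `H_P^R` of `H` in
  `𝔞_P^R = W_K ∩ W_J^⊥` (it is the orthogonal projection onto that subspace: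
  `relProj_mem`, `IsDualSystem.inner_root_relProj`, `IsDualSystem.inner_relProj_eq_of_mem`);
* `coneSet α ϖ J L K X` — Labesse–Waldspurger's set `C(P, Q, R, X)` of the `H` with
  `α(H) > 0` on `Δ_P^Q`, `α(H) ≤ 0` on `Δ_P^R ∖ Δ_P^Q`, `ϖ(H - X) > 0` on `Δ̂_Q^R` and
  `ϖ(H - X) ≤ 0` on `Δ̂_P^R ∖ Δ̂_Q^R`;
* `posRootSet`, `nonposWeightSet` — the largest `Q` with `τ_P^Q(H) = 1` and the smallest `Q`
  with `τ̂_Q^R(Y) = 1` (the sets `S`, `T` of the printed proofs of Prop. 1.7.2 and Lemme 1.8.3);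
* `gammaInd α ϖ J K H X` — the number `Γ_P^R(H, X)`; `gammaMatrix_apply` identifies it, up to
  the sign `(-1)^{a_P - a_R}`, with the `(P, R)` entry of the matrix `Γ(H, X) = τ(H) τ̂(H - X)` of
  `LanglandsCombinatorialLemma.lean`.

## Main results (all proved; no named facts are introduced)

* `IsDualSystem.inner_relRoot_relRoot_le`, `IsDualSystem.inner_relRoot_relRoot_nonpos` —
  **Lemme 1.2.4**: the projections `α_k - π_J α_k` (`k ∉ J`) of an obtuse basis to `W_J^⊥` form an
  obtuse family (indeed `⟪α̃_k, α̃_k'⟫ ≤ ⟪α_k, α_k'⟫`);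
* `IsDualSystem.inner_root_le_inner_root_sub_proj` — **Lemme 1.2.10** (with 1.2.9): for `X` in
  the closed positive chamber of `W_J`, `ᾱ(X) ≥ α(X)`, i.e. `⟪α k, X - π_J X⟫ ≥ ⟪α k, X⟫`, `k ∉ J`;
* `convex_coneSet` and `IsDualSystem.norm_relProj_le_of_mem_coneSet` — **Lemme 1.8.1**:
  `C(P, Q, R, X)` is convex and `‖H_P^R‖ ≤ c ‖X_P^R‖` on it.  We obtain the constant `c = 1`, and
  in fact (`IsDualSystem.norm_relProj_sub_half_le_of_mem_coneSet`) that `H_P^R` lies in the closed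
  ball with diameter `[0, X_P^R]`; see "Proofs" below;
* `IsDualSystem.coneSet_eq_empty_of_inner_root_nonneg`, `IsDualSystem.coneSet_zero` — the two
  vanishing statements of **Lemme 1.8.1**: for `X` in the closed positive chamber
  `C(P, Q, R, X) = ∅` unless `Q = R`, and `C(P, Q, R, 0) = ∅` unless `P = R`;
* `gammaInd_eq_sum_indicator`, `mem_coneSet_iff`, `disjoint_coneSet` — **Lemme 1.8.3**, first
  part: `Γ_P^R(·, X) = ∑_Q (-1)^{a_Q - a_R} 𝟙_{C(P,Q,R,X)}`, the `C(P, Q, R, X)` (`Q` varying)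
  being pairwise disjoint;
* `IsDualSystem.norm_relProj_le_of_gammaInd_ne_zero` (and the ball version) — **Lemme 1.8.3**,
  second part (Arthur 1981, Lemma 2.1): on the support of `H ↦ Γ_P^R(H, X)`,
  `‖H_P^R‖ ≤ ‖X_P^R‖`;
* `IsDualSystem.gammaInd_eq_tauInd_mul_phiInd` — **Lemme 1.8.3**, last part: for `X` in the
  closed positive chamber (Labesse–Waldspurger assume `X` regular, i.e. in the open chamber; the
  printed proof uses only the closed condition), `Γ_P^R(H, X) = τ_P^R(H) φ_P^R(H - X)` is the
  characteristic function of `{α(H) > 0, ϖ_α(H - X) ≤ 0 ∀ α ∈ Δ_P^R} = C(P, R, R, X)`;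
* `IsDualSystem.gammaInd_zero` — `Γ_P^R(H, 0) = δ_{P,R}` (the remark before Lemme 1.8.6, in the
  standard case; this is Langlands' combinatorial lemma again).

## Proofs

Everything follows the printed proofs except the bound of Lemme 1.8.1, where a shorter road is
taken.  Labesse–Waldspurger decompose `𝔞_P^R = 𝔞_S^R ⊕ 𝔞_Q^R` (`Δ_P^S = Δ_P^R ∖ Δ_P^Q`) and
confine the two projections `H_1`, `H_2` of `H` separately, through cone inequalities of the type
of Lemme 1.2.8, to compact sets depending on `X`.  Instead we observe that, `(α̃_k)` and `(ϖ K k)`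
(`k ∈ K ∖ J`) being dual bases of `𝔞_P^R`,
`⟪H_P^R - X_P^R, H_P^R⟫ = ∑_{k ∈ K ∖ J} ⟪ϖ K k, H - X⟫ · ⟪α k, H - π_J H⟫`
(`IsDualSystem.inner_relProj_relProj`), and that on `C(P, Q, R, X)` the two factors of every term
have opposite signs (`> 0`/`≤ 0` on `Δ_P^Q`, `≤ 0`/`> 0` on `Δ_P^R ∖ Δ_P^Q`).  Hence
`⟪H_P^R - X_P^R, H_P^R⟫ ≤ 0`, i.e. `H_P^R` lies in the ball with diameter `[0, X_P^R]`, which gives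
Labesse–Waldspurger's bound with `c = 1` and no dependence on the root data; it also gives the
case `X = 0` at once.  The vanishing for dominant `X` and `Q ≠ R` is the printed argument
(incompatible inequalities on `𝔞_Q^R`), run with the Gram matrix of the obtuse family
`(α̃_k)_{k ∈ K ∖ L}`: for `z = ∑_{k ∈ K ∖ L} ⟪ϖ K k, H - X⟫ α̃_k` one finds `⟪z, z⟫ ≤ 0` from
Lemme 1.2.4 and Lemme 1.2.10, while `⟪ϖ K k, z⟫ = ⟪ϖ K k, H - X⟫ > 0`.

## References

* J.-P. Labesse, J.-L. Waldspurger, *La formule des traces tordue d'après le Friday Morning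
  Seminar*, CRM Monograph Series 31, AMS, 2013 (arXiv:1204.2888) — Ch. 1, Lemmes 1.2.4, 1.2.9,
  1.2.10, §1.8: Lemme 1.8.1, Lemme 1.8.3. [LabesseWaldspurger2013]
* J. Arthur, *The trace formula in invariant form*, Ann. of Math. 114 (1981), 1–74 — §2,
  Lemma 2.1. [Arthur1981TraceFormulaInvariantForm]
* S. Shokranian, *The Selberg–Arthur trace formula*, Lecture Notes in Math. 1503, Springer,
  1992 — Ch. 5, Lemma 5.4 and Example 5.5 (the functions `Γ_P(H, X)`). [Shokranian1992]
* J. Arthur, *A trace formula for reductive groups I. Terms associated to classes in `G(ℚ)`*,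
  Duke Math. J. 45 (1978), 911–952 — §§5–6. [Arthur1978TraceFormulaI]
-/

noncomputable section

open Finset
open scoped RealInnerProductSpace

namespace Literature.NumberTheory.Automorphic

namespace ObtuseBasis

variable {V : Type*} [NormedAddCommGroup V] [InnerProductSpace ℝ V]
variable {ι : Type*}

/-! ## Linearity of the projections `π_J`, and the component `H_P^R` -/

section Linear

variable (α : ι → V) (ϖ : Finset ι → ι → V)

/-- `π_J (H + H') = π_J H + π_J H'`. [folklore] -/
theorem proj_add (J : Finset ι) (H H' : V) :
    proj α ϖ J (H + H') = proj α ϖ J H + proj α ϖ J H' := by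
  simp only [proj, inner_add_right, add_smul, Finset.sum_add_distrib]

/-- `π_J (c • H) = c • π_J H`. [folklore] -/
theorem proj_smul (J : Finset ι) (c : ℝ) (H : V) :
    proj α ϖ J (c • H) = c • proj α ϖ J H := by
  simp only [proj, real_inner_smul_right, Finset.smul_sum, smul_smul]

/-- `π_J (H - H') = π_J H - π_J H'`. [folklore] -/
theorem proj_sub (J : Finset ι) (H H' : V) :
    proj α ϖ J (H - H') = proj α ϖ J H - proj α ϖ J H' := by
  simp only [proj, inner_sub_right, sub_smul, Finset.sum_sub_distrib]

/-- `π_J 0 = 0`. [folklore] -/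
theorem proj_zero (J : Finset ι) : proj α ϖ J (0 : V) = 0 := by
  simp [proj]

/-- `H_P^R = π_K H - π_J H`, the component of `H` in `𝔞_P^R = W_K ∩ W_J^⊥`
(`J = Δ_0^P ⊆ K = Δ_0^R`); it is the orthogonal projection of `H` onto that subspace
(`relProj_mem`, `IsDualSystem.inner_root_relProj`, `IsDualSystem.inner_relProj_eq_of_mem`).
[cite: LabesseWaldspurger2013, Ch. 1, §1.1 (decompositions `𝔞_P = 𝔞_Q ⊕ 𝔞_P^Q`) and §1.8
(notation `H_P^R`, `X_P^R` in Lemme 1.8.1)] -/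
def relProj (J K : Finset ι) (H : V) : V :=
  proj α ϖ K H - proj α ϖ J H

/-- `(H - H')_P^R = H_P^R - H'_P^R`. [folklore] -/
theorem relProj_sub (J K : Finset ι) (H H' : V) :
    relProj α ϖ J K (H - H') = relProj α ϖ J K H - relProj α ϖ J K H' := by
  simp only [relProj, proj_sub]
  abel

/-- `0_P^R = 0`. [folklore] -/
theorem relProj_zero (J K : Finset ι) : relProj α ϖ J K (0 : V) = 0 := by
  simp [relProj, proj_zero]

end Linear

variable [DecidableEq ι]

section ProjAPI

variable {α : ι → V} {ϖ : Finset ι → ι → V}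

/-- `H - π_J H ⊥ W_J`. [folklore] -/
theorem IsDualSystem.inner_sub_proj_of_mem (h : IsDualSystem α ϖ) (J : Finset ι) (H : V) {y : V}
    (hy : y ∈ spanOn α J) : ⟪y, H - proj α ϖ J H⟫ = 0 := by
  obtain ⟨c, rfl⟩ := (mem_spanOn_iff α J y).1 hy
  rw [sum_inner]
  refine Finset.sum_eq_zero fun j hj => ?_
  rw [real_inner_smul_left, h.inner_root_sub_proj hj, mul_zero]

/-- `π_J y = y` for `y ∈ W_J`. [folklore] -/
theorem IsDualSystem.proj_eq_self (h : IsDualSystem α ϖ) {J : Finset ι} {y : V}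
    (hy : y ∈ spanOn α J) : proj α ϖ J y = y :=
  (h.eq_proj hy fun j _ => by rw [sub_self, inner_zero_right]).symm

/-- `π_J` is self-adjoint: `⟪x, π_J y⟫ = ⟪π_J x, y⟫`. [folklore] -/
theorem IsDualSystem.inner_proj_comm (h : IsDualSystem α ϖ) (J : Finset ι) (x y : V) :
    ⟪x, proj α ϖ J y⟫ = ⟪proj α ϖ J x, y⟫ := by
  have h1 : ⟪proj α ϖ J y, x⟫ = ⟪proj α ϖ J y, proj α ϖ J x⟫ := by
    have := h.inner_sub_proj_of_mem J x (proj_mem α ϖ J y)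
    rwa [inner_sub_right, sub_eq_zero] at this
  have h2 : ⟪proj α ϖ J x, y⟫ = ⟪proj α ϖ J x, proj α ϖ J y⟫ := by
    have := h.inner_sub_proj_of_mem J y (proj_mem α ϖ J x)
    rwa [inner_sub_right, sub_eq_zero] at this
  calc ⟪x, proj α ϖ J y⟫ = ⟪proj α ϖ J y, x⟫ := (real_inner_comm _ _).symm
    _ = ⟪proj α ϖ J y, proj α ϖ J x⟫ := h1
    _ = ⟪proj α ϖ J x, proj α ϖ J y⟫ := (real_inner_comm _ _).symm
    _ = ⟪proj α ϖ J x, y⟫ := h2.symm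

/-- `α(H_P) = ⟪α̃, H⟫` with `α̃ = α_k - π_J α_k` the projection of the root to `W_J^⊥`:
`⟪α k, H - π_J H⟫ = ⟪α k - π_J (α k), H⟫`. [folklore] -/
theorem IsDualSystem.inner_root_sub_proj_eq (h : IsDualSystem α ϖ) (J : Finset ι) (k : ι) (H : V) :
    ⟪α k, H - proj α ϖ J H⟫ = ⟪α k - proj α ϖ J (α k), H⟫ := by
  rw [inner_sub_right, inner_sub_left, h.inner_proj_comm J (α k) H]

/-- `π_J ∘ π_K = π_J` for `J ⊆ K`. [folklore] -/
theorem IsDualSystem.proj_proj (h : IsDualSystem α ϖ) {J K : Finset ι} (hJK : J ⊆ K) (H : V) :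
    proj α ϖ J (proj α ϖ K H) = proj α ϖ J H := by
  unfold proj
  refine Finset.sum_congr rfl fun j hj => ?_
  congr 1
  have := h.inner_sub_proj_of_mem K H (spanOn_mono α hJK (h.dual_mem hj))
  rw [inner_sub_right, sub_eq_zero] at this
  rw [proj] at this
  exact this.symm

/-! ### `H_P^R` is the orthogonal projection onto `𝔞_P^R = W_K ∩ W_J^⊥` -/

omit [DecidableEq ι] in
/-- `H_P^R ∈ W_K`. [folklore] -/
theorem relProj_mem (α : ι → V) (ϖ : Finset ι → ι → V) {J K : Finset ι} (hJK : J ⊆ K) (H : V) :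
    relProj α ϖ J K H ∈ spanOn α K :=
  Submodule.sub_mem _ (proj_mem α ϖ K H) (spanOn_mono α hJK (proj_mem α ϖ J H))

/-- `⟪α k, H_P^R⟫ = ⟪α k, H - π_J H⟫ = α(H_P)` for `k ∈ K`; in particular `H_P^R ⊥ W_J`.
[folklore] -/
theorem IsDualSystem.inner_root_relProj (h : IsDualSystem α ϖ) {J K : Finset ι} {k : ι}
    (hk : k ∈ K) (H : V) : ⟪α k, relProj α ϖ J K H⟫ = ⟪α k, H - proj α ϖ J H⟫ := by
  have h0 := h.inner_root_sub_proj hk H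
  rw [inner_sub_right, sub_eq_zero] at h0
  rw [relProj, inner_sub_right, inner_sub_right, ← h0]

/-- `H_P^R ⊥ W_J`: `⟪α j, H_P^R⟫ = 0` for `j ∈ J ⊆ K`. [folklore] -/
theorem IsDualSystem.inner_root_relProj_of_mem (h : IsDualSystem α ϖ) {J K : Finset ι}
    (hJK : J ⊆ K) {j : ι} (hj : j ∈ J) (H : V) : ⟪α j, relProj α ϖ J K H⟫ = 0 := by
  rw [h.inner_root_relProj (hJK hj), h.inner_root_sub_proj hj]

/-- `⟪ϖ K k, H_P^R⟫ = ⟪ϖ K k, H⟫ = ϖ(H)` for `k ∈ K ∖ J`. [folklore] -/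
theorem IsDualSystem.inner_dual_relProj (h : IsDualSystem α ϖ) {J K : Finset ι} (hJK : J ⊆ K)
    {k : ι} (hk : k ∈ K) (hkJ : k ∉ J) (H : V) :
    ⟪ϖ K k, relProj α ϖ J K H⟫ = ⟪ϖ K k, H⟫ := by
  rw [relProj, inner_sub_right, h.inner_dual_proj hJK hk hkJ, sub_zero]
  have := h.inner_sub_proj_of_mem K H (h.dual_mem hk)
  rw [inner_sub_right, sub_eq_zero] at this
  exact this.symm

omit [DecidableEq ι] in
/-- An element orthogonal to all the `α_j`, `j ∈ J`, is orthogonal to `W_J`. [folklore] -/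
theorem inner_eq_zero_of_forall_inner_root_eq_zero (α : ι → V) {J : Finset ι} {y x : V}
    (hx : x ∈ spanOn α J) (hy : ∀ j ∈ J, ⟪α j, y⟫ = 0) : ⟪x, y⟫ = 0 := by
  obtain ⟨c, rfl⟩ := (mem_spanOn_iff α J x).1 hx
  rw [sum_inner]
  refine Finset.sum_eq_zero fun j hj => ?_
  rw [real_inner_smul_left, hy j hj, mul_zero]

/-- `H_P^R` is the orthogonal projection of `H` onto `𝔞_P^R = W_K ∩ W_J^⊥`: every `y ∈ W_K`
orthogonal to `W_J` has the same inner product with `H` and with `H_P^R`. [folklore] -/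
theorem IsDualSystem.inner_relProj_eq_of_mem (h : IsDualSystem α ϖ) {J K : Finset ι}
    {y : V} (hyK : y ∈ spanOn α K) (hyJ : ∀ j ∈ J, ⟪α j, y⟫ = 0) (H : V) :
    ⟪y, relProj α ϖ J K H⟫ = ⟪y, H⟫ := by
  have h1 : ⟪y, proj α ϖ K H⟫ = ⟪y, H⟫ := by
    have := h.inner_sub_proj_of_mem K H hyK
    rw [inner_sub_right, sub_eq_zero] at this
    exact this.symm
  have h2 : ⟪y, proj α ϖ J H⟫ = 0 := by
    rw [h.inner_proj_comm J y H]
    have hpy : proj α ϖ J y = 0 := by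
      unfold proj
      refine Finset.sum_eq_zero fun j hj => ?_
      rw [inner_eq_zero_of_forall_inner_root_eq_zero α (h.dual_mem hj) hyJ, zero_smul]
    rw [hpy, inner_zero_left]
  rw [relProj, inner_sub_right, h1, h2, sub_zero]

/-- The basic identity behind Lemme 1.8.1: `(α̃_k)` and `(ϖ K k)` (`k ∈ K ∖ J`) are dual bases of
`𝔞_P^R`, so `⟪D_P^R, H_P^R⟫ = ∑_{k ∈ K ∖ J} ⟪ϖ K k, D⟫ ⟪α k, H - π_J H⟫`. [folklore] -/
theorem IsDualSystem.inner_relProj_relProj (h : IsDualSystem α ϖ) {J K : Finset ι}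
    (hJK : J ⊆ K) (D H : V) :
    ⟪relProj α ϖ J K D, relProj α ϖ J K H⟫
      = ∑ k ∈ K \ J, ⟪ϖ K k, D⟫ * ⟪α k, H - proj α ϖ J H⟫ := by
  rw [h.inner_eq_sum_inner_dual_mul_inner_root (relProj_mem α ϖ hJK D) _, ← Finset.sum_sdiff hJK]
  have hJ0 : ∑ k ∈ J, ⟪ϖ K k, relProj α ϖ J K D⟫ * ⟪α k, relProj α ϖ J K H⟫ = 0 :=
    Finset.sum_eq_zero fun j hj => by rw [h.inner_root_relProj_of_mem hJK hj, mul_zero]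
  rw [hJ0, add_zero]
  refine Finset.sum_congr rfl fun k hk => ?_
  obtain ⟨hkK, hkJ⟩ := Finset.mem_sdiff.1 hk
  rw [h.inner_dual_relProj hJK hkK hkJ, h.inner_root_relProj hkK]

end ProjAPI


/-! ## Lemme 1.2.4: the relative basis is obtuse; Lemme 1.2.10: dominance improves under
projection -/

section RelativeRoots

variable {α : ι → V} {ϖ : Finset ι → ι → V}

/-- `⟪ϖ J j, α k⟫ ≤ 0` for `j ∈ J` and `k ∉ J` (a root off the Levi pairs non-positively with the
fundamental weights of the Levi: `ϖ J j` is a non-negative combination of the `α_j'`, `j' ∈ J`).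
[cite: LabesseWaldspurger2013, Ch. 1, Lemme 1.2.8 (proof) and Lemme 1.2.6] -/
theorem IsDualSystem.inner_dual_root_nonpos (h : IsDualSystem α ϖ) (hobt : IsObtuse α)
    {J : Finset ι} (hli : LinIndepOn α J) {j k : ι} (hj : j ∈ J) (hk : k ∉ J) :
    ⟪ϖ J j, α k⟫ ≤ 0 := by
  rw [h.dual_eq_sum hj, sum_inner]
  refine Finset.sum_nonpos fun j' hj' => ?_
  rw [real_inner_smul_left]
  have hne : j' ≠ k := fun e => hk (e ▸ hj')
  exact mul_nonpos_of_nonneg_of_nonpos (h.inner_dual_dual_nonneg hobt hli hj' hj) (hobt j' k hne)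

/-- `0 ≤ ⟪α k, π_J (α k')⟫` for `k, k' ∉ J`. [cite: LabesseWaldspurger2013, Ch. 1, Lemme 1.2.4 (proof)] -/
theorem IsDualSystem.inner_root_proj_root_nonneg (h : IsDualSystem α ϖ) (hobt : IsObtuse α)
    {J : Finset ι} (hli : LinIndepOn α J) {k k' : ι} (hk : k ∉ J) (hk' : k' ∉ J) :
    0 ≤ ⟪α k, proj α ϖ J (α k')⟫ := by
  rw [proj, inner_sum]
  refine Finset.sum_nonneg fun j hj => ?_
  rw [real_inner_smul_right]
  have hne : k ≠ j := fun e => hk (e ▸ hj)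
  exact mul_nonneg_of_nonpos_of_nonpos (h.inner_dual_root_nonpos hobt hli hj hk') (hobt k j hne)

/-- **Labesse–Waldspurger, Lemme 1.2.4** (the projection of an obtuse basis to the orthogonal of
a sub-family is obtuse), in quantitative form: with `α̃_k = α_k - π_J α_k`,
`⟪α̃_k, α̃_k'⟫ ≤ ⟪α_k, α_k'⟫` for `k, k' ∉ J`.  (The printed proof removes one vector at a time;
here the whole of `J` is removed at once through the obtuse-basis lemma.)
[cite: LabesseWaldspurger2013, Ch. 1, Lemme 1.2.4] -/
theorem IsDualSystem.inner_relRoot_relRoot_le (h : IsDualSystem α ϖ) (hobt : IsObtuse α)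
    {J : Finset ι} (hli : LinIndepOn α J) {k k' : ι} (hk : k ∉ J) (hk' : k' ∉ J) :
    ⟪α k - proj α ϖ J (α k), α k' - proj α ϖ J (α k')⟫ ≤ ⟪α k, α k'⟫ := by
  have h0 : ⟪proj α ϖ J (α k), α k' - proj α ϖ J (α k')⟫ = 0 :=
    h.inner_sub_proj_of_mem J (α k') (proj_mem α ϖ J (α k))
  rw [inner_sub_left, h0, sub_zero, inner_sub_right]
  linarith [h.inner_root_proj_root_nonneg hobt hli hk hk']

/-- **Labesse–Waldspurger, Lemme 1.2.4**: the relative simple roots `Δ_P^R` — the projections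
`α̃_k = α_k - π_J α_k`, `k ∉ J`, of the simple roots off `J = Δ_0^P` — form an obtuse family:
`⟪α̃_k, α̃_k'⟫ ≤ 0` for `k ≠ k'`. [cite: LabesseWaldspurger2013, Ch. 1, Lemme 1.2.4 and Lemme 1.2.6] -/
theorem IsDualSystem.inner_relRoot_relRoot_nonpos (h : IsDualSystem α ϖ) (hobt : IsObtuse α)
    {J : Finset ι} (hli : LinIndepOn α J) {k k' : ι} (hk : k ∉ J) (hk' : k' ∉ J) (hne : k ≠ k') :
    ⟪α k - proj α ϖ J (α k), α k' - proj α ϖ J (α k')⟫ ≤ 0 :=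
  (h.inner_relRoot_relRoot_le hobt hli hk hk').trans (hobt k k' hne)

/-- For `X` in the closed positive chamber of `W_J` (`⟪α j, X⟫ ≥ 0` for `j ∈ J`), the fundamental
weights of `J` are non-negative on `X`: `⟪ϖ J j, X⟫ ≥ 0` (closed-chamber form of Lemme 1.2.8).
[cite: LabesseWaldspurger2013, Ch. 1, Lemme 1.2.8] -/
theorem IsDualSystem.inner_dual_nonneg_of_inner_root_nonneg (h : IsDualSystem α ϖ)
    (hobt : IsObtuse α) {J : Finset ι} (hli : LinIndepOn α J) {X : V}
    (hX : ∀ j ∈ J, 0 ≤ ⟪α j, X⟫) {j : ι} (hj : j ∈ J) : 0 ≤ ⟪ϖ J j, X⟫ := by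
  rw [h.dual_eq_sum hj, sum_inner]
  refine Finset.sum_nonneg fun j' hj' => ?_
  rw [real_inner_smul_left]
  exact mul_nonneg (h.inner_dual_dual_nonneg hobt hli hj' hj) (hX j' hj')

/-- **Labesse–Waldspurger, Lemme 1.2.10** (with Lemme 1.2.9): for `X` in the closed positive
chamber of `W_J` and `k ∉ J`, the relative root dominates the absolute one,
`ᾱ(X) = ⟪α k, X - π_J X⟫ ≥ ⟪α k, X⟫ = α(X)`.  (Labesse–Waldspurger take `X` regular, i.e. in the
open positive chamber of all the simple roots, and conclude `ᾱ(X) ≥ α(X) ≥ d_{P_0}(X) > 0`.)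
[cite: LabesseWaldspurger2013, Ch. 1, Lemme 1.2.10 and Lemme 1.2.9] -/
theorem IsDualSystem.inner_root_le_inner_root_sub_proj (h : IsDualSystem α ϖ) (hobt : IsObtuse α)
    {J : Finset ι} (hli : LinIndepOn α J) {X : V} (hX : ∀ j ∈ J, 0 ≤ ⟪α j, X⟫) {k : ι}
    (hk : k ∉ J) : ⟪α k, X⟫ ≤ ⟪α k, X - proj α ϖ J X⟫ := by
  have hle : ⟪α k, proj α ϖ J X⟫ ≤ 0 := by
    rw [proj, inner_sum]
    refine Finset.sum_nonpos fun j hj => ?_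
    rw [real_inner_smul_right]
    have hne : k ≠ j := fun e => hk (e ▸ hj)
    exact mul_nonpos_of_nonneg_of_nonpos
      (h.inner_dual_nonneg_of_inner_root_nonneg hobt hli hX hj) (hobt k j hne)
  rw [inner_sub_right]
  linarith

end RelativeRoots


/-! ## The convex sets `C(P, Q, R, X)` (Labesse–Waldspurger, Lemme 1.8.1) -/

section ConeSets

variable (α : ι → V) (ϖ : Finset ι → ι → V)

/-- Labesse–Waldspurger's set `C(P, Q, R, X)` for `P ⊂ Q ⊂ R` and `X ∈ 𝔞_0`
(`J = Δ_0^P ⊆ L = Δ_0^Q ⊆ K = Δ_0^R`): the `H` such that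
`α(H) > 0` for `α ∈ Δ_P^Q` (`k ∈ L ∖ J`), `α(H) ≤ 0` for `α ∈ Δ_P^R ∖ Δ_P^Q` (`k ∈ K ∖ L`),
`ϖ(H - X) > 0` for `ϖ ∈ Δ̂_Q^R` (`k ∈ K ∖ L`) and `ϖ(H - X) ≤ 0` for `ϖ ∈ Δ̂_P^R ∖ Δ̂_Q^R`
(`k ∈ L ∖ J`). [cite: LabesseWaldspurger2013, Ch. 1, §1.8 (before Lemme 1.8.1)] -/
def coneSet (J L K : Finset ι) (X : V) : Set V :=
  {H | (∀ k ∈ L \ J, 0 < ⟪α k, H - proj α ϖ J H⟫) ∧ (∀ k ∈ K \ L, ⟪α k, H - proj α ϖ J H⟫ ≤ 0) ∧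
    (∀ k ∈ K \ L, 0 < ⟪ϖ K k, H - X⟫) ∧ (∀ k ∈ L \ J, ⟪ϖ K k, H - X⟫ ≤ 0)}

/-- Unfolding of `coneSet`. [folklore] -/
theorem mem_coneSet {J L K : Finset ι} {X H : V} :
    H ∈ coneSet α ϖ J L K X ↔
      (∀ k ∈ L \ J, 0 < ⟪α k, H - proj α ϖ J H⟫) ∧ (∀ k ∈ K \ L, ⟪α k, H - proj α ϖ J H⟫ ≤ 0) ∧
      (∀ k ∈ K \ L, 0 < ⟪ϖ K k, H - X⟫) ∧ (∀ k ∈ L \ J, ⟪ϖ K k, H - X⟫ ≤ 0) :=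
  Iff.rfl

/-- A convex combination of two positive reals is positive. [folklore] -/
private theorem pos_of_convex_comb {a b x y : ℝ} (ha : 0 ≤ a) (hb : 0 ≤ b) (hab : a + b = 1)
    (hx : 0 < x) (hy : 0 < y) : 0 < a * x + b * y := by
  rcases ha.eq_or_lt with rfl | ha'
  · rw [zero_add] at hab
    rw [hab, zero_mul, zero_add, one_mul]
    exact hy
  · exact add_pos_of_pos_of_nonneg (mul_pos ha' hx) (mul_nonneg hb hy.le)

/-- **Labesse–Waldspurger, Lemme 1.8.1** (first assertion): `C(P, Q, R, X)` is convex — it is an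
intersection of open and closed half-spaces. [cite: LabesseWaldspurger2013, Ch. 1, Lemme 1.8.1] -/
theorem convex_coneSet (J L K : Finset ι) (X : V) : Convex ℝ (coneSet α ϖ J L K X) := by
  refine convex_iff_add_mem.2 fun H₁ h₁ H₂ h₂ a b ha hb hab => ?_
  rw [mem_coneSet] at h₁ h₂ ⊢
  obtain ⟨h₁A, h₁B, h₁C, h₁D⟩ := h₁
  obtain ⟨h₂A, h₂B, h₂C, h₂D⟩ := h₂
  have hP : a • H₁ + b • H₂ - proj α ϖ J (a • H₁ + b • H₂)
      = a • (H₁ - proj α ϖ J H₁) + b • (H₂ - proj α ϖ J H₂) := by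
    rw [proj_add, proj_smul, proj_smul, smul_sub, smul_sub]
    abel
  have hX : a • H₁ + b • H₂ - X = a • (H₁ - X) + b • (H₂ - X) := by
    calc a • H₁ + b • H₂ - X = a • H₁ + b • H₂ - (a + b) • X := by rw [hab, one_smul]
      _ = a • (H₁ - X) + b • (H₂ - X) := by rw [add_smul, smul_sub, smul_sub]; abel
  refine ⟨fun k hk => ?_, fun k hk => ?_, fun k hk => ?_, fun k hk => ?_⟩
  · rw [hP, inner_add_right, real_inner_smul_right, real_inner_smul_right]
    exact pos_of_convex_comb ha hb hab (h₁A k hk) (h₂A k hk)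
  · rw [hP, inner_add_right, real_inner_smul_right, real_inner_smul_right]
    exact add_nonpos (mul_nonpos_of_nonneg_of_nonpos ha (h₁B k hk))
      (mul_nonpos_of_nonneg_of_nonpos hb (h₂B k hk))
  · rw [hX, inner_add_right, real_inner_smul_right, real_inner_smul_right]
    exact pos_of_convex_comb ha hb hab (h₁C k hk) (h₂C k hk)
  · rw [hX, inner_add_right, real_inner_smul_right, real_inner_smul_right]
    exact add_nonpos (mul_nonpos_of_nonneg_of_nonpos ha (h₁D k hk))
      (mul_nonpos_of_nonneg_of_nonpos hb (h₂D k hk))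

variable {α ϖ}

/-- The heart of Lemme 1.8.1: for `H ∈ C(P, Q, R, X)`, `⟪H_P^R - X_P^R, H_P^R⟫ ≤ 0` — in the
expansion `∑_{k ∈ K ∖ J} ⟪ϖ K k, H - X⟫ ⟪α k, H - π_J H⟫` every term is `≤ 0`.
[cite: LabesseWaldspurger2013, Ch. 1, Lemme 1.8.1] -/
theorem IsDualSystem.inner_relProj_sub_relProj_nonpos (h : IsDualSystem α ϖ) {J L K : Finset ι}
    (hJL : J ⊆ L) (hLK : L ⊆ K) {X H : V} (hH : H ∈ coneSet α ϖ J L K X) :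
    ⟪relProj α ϖ J K H - relProj α ϖ J K X, relProj α ϖ J K H⟫ ≤ 0 := by
  obtain ⟨hA, hB, hC, hD⟩ := hH
  rw [← relProj_sub, h.inner_relProj_relProj (hJL.trans hLK) (H - X) H]
  refine Finset.sum_nonpos fun k hk => ?_
  obtain ⟨hkK, hkJ⟩ := Finset.mem_sdiff.1 hk
  by_cases hkL : k ∈ L
  · exact mul_nonpos_of_nonpos_of_nonneg (hD k (Finset.mem_sdiff.2 ⟨hkL, hkJ⟩))
      (hA k (Finset.mem_sdiff.2 ⟨hkL, hkJ⟩)).le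
  · exact mul_nonpos_of_nonneg_of_nonpos (hC k (Finset.mem_sdiff.2 ⟨hkK, hkL⟩)).le
      (hB k (Finset.mem_sdiff.2 ⟨hkK, hkL⟩))

/-- A vector `u` with `⟪u - v, u⟫ ≤ 0` lies in the closed ball with diameter `[0, v]` (Thales).
[folklore] -/
theorem norm_sub_half_smul_le_of_inner_sub_nonpos {u v : V} (huv : ⟪u - v, u⟫ ≤ 0) :
    ‖u - (1 / 2 : ℝ) • v‖ ≤ 1 / 2 * ‖v‖ := by
  rw [inner_sub_left, real_inner_self_eq_norm_sq, sub_nonpos] at huv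
  have hsq : ‖u - (1 / 2 : ℝ) • v‖ ^ 2 ≤ (1 / 2 * ‖v‖) ^ 2 := by
    rw [norm_sub_sq_real, real_inner_smul_right, norm_smul, Real.norm_eq_abs,
      abs_of_pos (by norm_num : (0 : ℝ) < 1 / 2), ← real_inner_comm u v]
    nlinarith [huv]
  exact (sq_le_sq₀ (norm_nonneg _) (by positivity)).1 hsq

/-- From the ball with diameter `[0, v]` to the ball of radius `‖v‖` about `0`. [folklore] -/
theorem norm_le_of_inner_sub_nonpos {u v : V} (huv : ⟪u - v, u⟫ ≤ 0) : ‖u‖ ≤ ‖v‖ := by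
  have hball := norm_sub_half_smul_le_of_inner_sub_nonpos huv
  have hhalf : ‖(1 / 2 : ℝ) • v‖ = 1 / 2 * ‖v‖ := by
    rw [norm_smul, Real.norm_eq_abs, abs_of_pos (by norm_num : (0 : ℝ) < 1 / 2)]
  calc ‖u‖ = ‖(u - (1 / 2 : ℝ) • v) + (1 / 2 : ℝ) • v‖ := by rw [sub_add_cancel]
    _ ≤ ‖u - (1 / 2 : ℝ) • v‖ + ‖(1 / 2 : ℝ) • v‖ := norm_add_le _ _
    _ ≤ 1 / 2 * ‖v‖ + 1 / 2 * ‖v‖ := add_le_add hball hhalf.le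
    _ = ‖v‖ := by ring

/-- **Labesse–Waldspurger, Lemme 1.8.1** (main assertion), sharpened: for `H ∈ C(P, Q, R, X)` the
component `H_P^R` lies in the closed ball with diameter `[0, X_P^R]`:
`‖H_P^R - X_P^R / 2‖ ≤ ‖X_P^R‖ / 2`. [cite: LabesseWaldspurger2013, Ch. 1, Lemme 1.8.1] -/
theorem IsDualSystem.norm_relProj_sub_half_le_of_mem_coneSet (h : IsDualSystem α ϖ)
    {J L K : Finset ι} (hJL : J ⊆ L) (hLK : L ⊆ K) {X H : V} (hH : H ∈ coneSet α ϖ J L K X) :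
    ‖relProj α ϖ J K H - (1 / 2 : ℝ) • relProj α ϖ J K X‖ ≤ 1 / 2 * ‖relProj α ϖ J K X‖ :=
  norm_sub_half_smul_le_of_inner_sub_nonpos (h.inner_relProj_sub_relProj_nonpos hJL hLK hH)

/-- **Labesse–Waldspurger, Lemme 1.8.1** (main assertion: "il existe `c > 0` tel que l'on ait
`‖H_P^R‖ ≤ c ‖X_P^R‖` pour `H ∈ C(P, Q, R, X)`"), with the constant `c = 1`: the projection of
`C(P, Q, R, X)` to `𝔞_P^R` is bounded by `‖X_P^R‖`, hence relatively compact.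
[cite: LabesseWaldspurger2013, Ch. 1, Lemme 1.8.1] -/
theorem IsDualSystem.norm_relProj_le_of_mem_coneSet (h : IsDualSystem α ϖ) {J L K : Finset ι}
    (hJL : J ⊆ L) (hLK : L ⊆ K) {X H : V} (hH : H ∈ coneSet α ϖ J L K X) :
    ‖relProj α ϖ J K H‖ ≤ ‖relProj α ϖ J K X‖ :=
  norm_le_of_inner_sub_nonpos (h.inner_relProj_sub_relProj_nonpos hJL hLK hH)

/-- **Labesse–Waldspurger, Lemme 1.8.1** (last assertion): `C(P, Q, R, 0)` is empty unless
`P = R`. [cite: LabesseWaldspurger2013, Ch. 1, Lemme 1.8.1] -/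
theorem IsDualSystem.coneSet_zero (h : IsDualSystem α ϖ) {J L K : Finset ι} (hJL : J ⊆ L)
    (hLK : L ⊆ K) (hJK : J ≠ K) : coneSet α ϖ J L K (0 : V) = ∅ := by
  ext H
  simp only [Set.mem_empty_iff_false, iff_false]
  intro hH
  have hle := h.norm_relProj_le_of_mem_coneSet hJL hLK hH
  rw [relProj_zero, norm_zero, norm_le_zero_iff] at hle
  obtain ⟨hA, -, hC, -⟩ := hH
  by_cases hLJ : L ⊆ J
  · -- `Q = P`: some weight condition `ϖ(H) > 0` on `K ∖ J ≠ ∅` fails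
    obtain ⟨k, hk⟩ : (K \ L).Nonempty :=
      Finset.sdiff_nonempty.2 fun hKL => hJK (Finset.Subset.antisymm (hJL.trans hLK) (hKL.trans hLJ))
    obtain ⟨hkK, hkL⟩ := Finset.mem_sdiff.1 hk
    have hpos := hC k hk
    rw [sub_zero, ← h.inner_dual_relProj (hJL.trans hLK) hkK (fun hkJ => hkL (hJL hkJ)) H, hle,
      inner_zero_right] at hpos
    exact lt_irrefl _ hpos
  · -- `Q ≠ P`: some root condition `α(H) > 0` on `L ∖ J ≠ ∅` fails
    obtain ⟨k, hk⟩ : (L \ J).Nonempty := Finset.sdiff_nonempty.2 hLJ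
    obtain ⟨hkL, -⟩ := Finset.mem_sdiff.1 hk
    have hpos := hA k hk
    rw [← h.inner_root_relProj (hLK hkL) H, hle, inner_zero_right] at hpos
    exact lt_irrefl _ hpos

/-- `K ∖ J` splits as `(K ∖ L) ⊔ (L ∖ J)` for `J ⊆ L ⊆ K`. [folklore] -/
private theorem sdiff_eq_sdiff_union_sdiff {J L K : Finset ι} (hJL : J ⊆ L) (hLK : L ⊆ K) :
    K \ J = (K \ L) ∪ (L \ J) := by
  ext k
  simp only [Finset.mem_sdiff, Finset.mem_union]
  constructor
  · rintro ⟨hkK, hkJ⟩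
    by_cases hkL : k ∈ L
    · exact Or.inr ⟨hkL, hkJ⟩
    · exact Or.inl ⟨hkK, hkL⟩
  · rintro (⟨hkK, hkL⟩ | ⟨hkL, hkJ⟩)
    · exact ⟨hkK, fun hkJ => hkL (hJL hkJ)⟩
    · exact ⟨hLK hkL, hkJ⟩

omit [DecidableEq ι] in
/-- `K ∖ L` and `L ∖ J` are disjoint. [folklore] -/
private theorem disjoint_sdiff_sdiff' [DecidableEq ι] (J L K : Finset ι) :
    Disjoint (K \ L) (L \ J) :=
  Finset.disjoint_left.2 fun _ hk hk' => (Finset.mem_sdiff.1 hk).2 (Finset.mem_sdiff.1 hk').1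

/-- Expansion of a relative root value along the Gram matrix of the relative basis: for `k ∈ K`,
`⟪α k, D - π_J D⟫ = ∑_{k' ∈ K ∖ J} ⟪ϖ K k', D⟫ ⟪α̃_k, α̃_k'⟫`. [folklore] -/
theorem IsDualSystem.inner_root_sub_proj_eq_sum (h : IsDualSystem α ϖ) {J K : Finset ι}
    (hJK : J ⊆ K) {k : ι} (hk : k ∈ K) (D : V) :
    ⟪α k, D - proj α ϖ J D⟫
      = ∑ k' ∈ K \ J, ⟪ϖ K k', D⟫ * ⟪α k - proj α ϖ J (α k), α k' - proj α ϖ J (α k')⟫ := by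
  have hmem : α k - proj α ϖ J (α k) ∈ spanOn α K :=
    Submodule.sub_mem _ (mem_spanOn_self α hk) (spanOn_mono α hJK (proj_mem α ϖ J (α k)))
  rw [h.inner_root_sub_proj_eq, h.inner_eq_sum_inner_root_mul_inner_dual hmem D,
    ← Finset.sum_sdiff hJK]
  have hJ0 : ∑ k' ∈ J, ⟪α k', α k - proj α ϖ J (α k)⟫ * ⟪ϖ K k', D⟫ = 0 :=
    Finset.sum_eq_zero fun j hj => by rw [h.inner_root_sub_proj hj, zero_mul]
  rw [hJ0, add_zero]
  refine Finset.sum_congr rfl fun k' hk' => ?_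
  have h0 : ⟪proj α ϖ J (α k'), α k - proj α ϖ J (α k)⟫ = 0 :=
    h.inner_sub_proj_of_mem J (α k) (proj_mem α ϖ J (α k'))
  have hsym : ⟪α k', α k - proj α ϖ J (α k)⟫ = ⟪α k - proj α ϖ J (α k), α k' - proj α ϖ J (α k')⟫ := by
    rw [← real_inner_comm (α k - proj α ϖ J (α k)), inner_sub_left, h0, sub_zero]
  rw [hsym, mul_comm]

/-- **Labesse–Waldspurger, Lemme 1.8.1** (second assertion): if `X` lies in the closed positive
chamber (`⟪α k, X⟫ ≥ 0` for `k ∈ K = Δ_0^R`; in particular if `X` is regular) then `C(P, Q, R, X)`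
is empty unless `Q = R`.  The printed argument: on `𝔞_Q^R` the weights of `H - X` are `> 0`
while the (relative) roots of `H - X` are `≤ 0`, which is incompatible for `Q ≠ R`; here it is
run on `z = ∑_{k ∈ K ∖ L} ⟪ϖ K k, H - X⟫ α̃_k`, for which `⟪z, z⟫ ≤ 0` by Lemme 1.2.4 and
Lemme 1.2.10 but `⟪ϖ K k, z⟫ = ⟪ϖ K k, H - X⟫ > 0`.
[cite: LabesseWaldspurger2013, Ch. 1, Lemme 1.8.1] -/
theorem IsDualSystem.coneSet_eq_empty_of_inner_root_nonneg (h : IsDualSystem α ϖ)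
    (hobt : IsObtuse α) {J L K : Finset ι} (hli : LinIndepOn α K) (hJL : J ⊆ L) (hLK : L ⊆ K)
    (hLK' : L ≠ K) {X : V} (hX : ∀ k ∈ K, 0 ≤ ⟪α k, X⟫) : coneSet α ϖ J L K X = ∅ := by
  ext H
  simp only [Set.mem_empty_iff_false, iff_false]
  rintro ⟨-, hB, hC, hD⟩
  have hJK : J ⊆ K := hJL.trans hLK
  have hliJ : LinIndepOn α J := hli.mono hJK
  -- notation: `D = H - X`, relative roots `αt k`, weight values `x k`, the vector `z`
  set D : V := H - X with hDdef
  set αt : ι → V := fun k => α k - proj α ϖ J (α k) with hαt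
  set x : ι → ℝ := fun k => ⟪ϖ K k, D⟫ with hxdef
  set z : V := ∑ k ∈ K \ L, x k • αt k with hzdef
  -- (1) for `k ∈ K ∖ L`: `∑_{k' ∈ K ∖ L} x k' ⟪αt k, αt k'⟫ ≤ 0`
  have hrow : ∀ k ∈ K \ L, ∑ k' ∈ K \ L, x k' * ⟪αt k, αt k'⟫ ≤ 0 := by
    intro k hk
    obtain ⟨hkK, hkL⟩ := Finset.mem_sdiff.1 hk
    have hkJ : k ∉ J := fun hkJ => hkL (hJL hkJ)
    -- `a_k(D) = a_k(H) - a_k(X) ≤ 0`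
    have haD : ⟪α k, D - proj α ϖ J D⟫ ≤ 0 := by
      have hsplit : ⟪α k, D - proj α ϖ J D⟫
          = ⟪α k, H - proj α ϖ J H⟫ - ⟪α k, X - proj α ϖ J X⟫ := by
        rw [hDdef, proj_sub, ← inner_sub_right]
        congr 1
        abel
      have haX : 0 ≤ ⟪α k, X - proj α ϖ J X⟫ :=
        (hX k hkK).trans (h.inner_root_le_inner_root_sub_proj hobt hliJ (fun j hj => hX j (hJK hj)) hkJ)
      rw [hsplit]
      linarith [hB k hk]
    -- `a_k(D) = ∑_{K ∖ L} + ∑_{L ∖ J}` and the second sum is `≥ 0`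
    rw [h.inner_root_sub_proj_eq_sum hJK hkK D, sdiff_eq_sdiff_union_sdiff hJL hLK,
      Finset.sum_union (disjoint_sdiff_sdiff' J L K)] at haD
    have hLJ : 0 ≤ ∑ k' ∈ L \ J, x k' * ⟪αt k, αt k'⟫ := by
      refine Finset.sum_nonneg fun k' hk' => ?_
      obtain ⟨hk'L, hk'J⟩ := Finset.mem_sdiff.1 hk'
      have hne : k ≠ k' := fun e => hkL (e ▸ hk'L)
      exact mul_nonneg_of_nonpos_of_nonpos (hD k' hk')
        (h.inner_relRoot_relRoot_nonpos hobt hliJ hkJ hk'J hne)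
    linarith
  -- (2) hence `⟪z, z⟫ ≤ 0`, so `z = 0`
  have hzz : z = 0 := by
    have hle : ⟪z, z⟫ ≤ 0 := by
      conv_lhs => rw [hzdef]
      rw [sum_inner]
      refine Finset.sum_nonpos fun k hk => ?_
      rw [real_inner_smul_left, inner_sum]
      have : ∑ k' ∈ K \ L, ⟪αt k, x k' • αt k'⟫ = ∑ k' ∈ K \ L, x k' * ⟪αt k, αt k'⟫ :=
        Finset.sum_congr rfl fun k' _ => by rw [real_inner_smul_right]
      rw [this]
      exact mul_nonpos_of_nonneg_of_nonpos (hC k hk).le (hrow k hk)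
    exact real_inner_self_nonpos.1 hle
  -- (3) but `⟪ϖ K k₀, z⟫ = x k₀ > 0` for any `k₀ ∈ K ∖ L ≠ ∅`
  obtain ⟨k₀, hk₀⟩ : (K \ L).Nonempty :=
    Finset.sdiff_nonempty.2 fun hKL => hLK' (Finset.Subset.antisymm hLK hKL)
  obtain ⟨hk₀K, hk₀L⟩ := Finset.mem_sdiff.1 hk₀
  have hk₀J : k₀ ∉ J := fun hkJ => hk₀L (hJL hkJ)
  have hpair : ⟪ϖ K k₀, z⟫ = x k₀ := by
    rw [hzdef, inner_sum, Finset.sum_eq_single_of_mem k₀ hk₀]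
    · rw [real_inner_smul_right, hαt]
      simp only
      rw [inner_sub_right, h.inner_dual_root_self hk₀K, h.inner_dual_proj hJK hk₀K hk₀J, sub_zero,
        mul_one]
    · intro k hk hkk
      obtain ⟨hkK, hkL⟩ := Finset.mem_sdiff.1 hk
      rw [real_inner_smul_right, hαt]
      simp only
      rw [inner_sub_right, h.inner_dual_root_of_ne hk₀K hkK (Ne.symm hkk),
        h.inner_dual_proj hJK hk₀K hk₀J, sub_zero, mul_zero]
  have hpos : 0 < x k₀ := hC k₀ hk₀
  rw [← hpair, hzz, inner_zero_right] at hpos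
  exact lt_irrefl _ hpos

end ConeSets


/-! ## The functions `Γ_P^R(H, X)` (Labesse–Waldspurger, Lemme 1.8.3) -/

section Gamma

variable (α : ι → V) (ϖ : Finset ι → ι → V)

/-- `Γ_P^R(H, X) = ∑_{Q : P ⊂ Q ⊂ R} (-1)^{a_Q - a_R} τ_P^Q(H) τ̂_Q^R(H - X)`
(`J = Δ_0^P`, `K = Δ_0^R`, sum over `L = Δ_0^Q`, `a_Q - a_R = |K ∖ L|`).
[cite: LabesseWaldspurger2013, Ch. 1, §1.8 (before Lemme 1.8.2)] -/
def gammaInd (J K : Finset ι) (H X : V) : ℝ :=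
  ∑ L ∈ Finset.Icc J K, (-1 : ℝ) ^ (K \ L).card * tauInd α ϖ J L H * hatTauInd ϖ L K (H - X)

/-- `S(H) = Δ_0^P ∪ {k ∈ K ∖ J : α_k(H_P) > 0}` — the largest `Q` between `P` and `R` with
`τ_P^Q(H) = 1` (`tau_iff_subset_posRootSet`).
[cite: LabesseWaldspurger2013, Ch. 1, Prop. 1.7.2 (proof) and Lemme 1.8.3 (proof)] -/
def posRootSet (J K : Finset ι) (H : V) : Finset ι :=
  J ∪ (K \ J).filter fun k => 0 < ⟪α k, H - proj α ϖ J H⟫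

/-- `T(Y) = Δ_0^P ∪ {k ∈ K ∖ J : ϖ_k(Y) ≤ 0}` — the smallest `Q` between `P` and `R` with
`τ̂_Q^R(Y) = 1` (`hatTau_iff_nonposWeightSet_subset`).
[cite: LabesseWaldspurger2013, Ch. 1, Prop. 1.7.2 (proof) and Lemme 1.8.3 (proof)] -/
def nonposWeightSet (J K : Finset ι) (Y : V) : Finset ι :=
  J ∪ (K \ J).filter fun k => ⟪ϖ K k, Y⟫ ≤ 0

variable {α ϖ}

/-- `(∀ k ∈ L ∖ J, p k) ↔ L ⊆ J ∪ {k ∈ K ∖ J : p k}` for `L ⊆ K`. [folklore] -/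
private theorem forall_sdiff_iff_subset {J L K : Finset ι} (p : ι → Prop) [DecidablePred p]
    (hLK : L ⊆ K) : (∀ k ∈ L \ J, p k) ↔ L ⊆ J ∪ (K \ J).filter p := by
  constructor
  · intro hp k hkL
    by_cases hkJ : k ∈ J
    · exact Finset.mem_union_left _ hkJ
    · exact Finset.mem_union_right _ (Finset.mem_filter.2
        ⟨Finset.mem_sdiff.2 ⟨hLK hkL, hkJ⟩, hp k (Finset.mem_sdiff.2 ⟨hkL, hkJ⟩)⟩)
  · intro hL k hk
    obtain ⟨hkL, hkJ⟩ := Finset.mem_sdiff.1 hk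
    rcases Finset.mem_union.1 (hL hkL) with hkJ' | hf
    · exact absurd hkJ' hkJ
    · exact (Finset.mem_filter.1 hf).2

/-- `(∀ k ∈ K ∖ L, ¬ p k) ↔ J ∪ {k ∈ K ∖ J : p k} ⊆ L` for `J ⊆ L`. [folklore] -/
private theorem forall_sdiff_not_iff_subset {J L K : Finset ι} (p : ι → Prop) [DecidablePred p]
    (hJL : J ⊆ L) : (∀ k ∈ K \ L, ¬ p k) ↔ J ∪ (K \ J).filter p ⊆ L := by
  constructor
  · intro hn k hk
    rcases Finset.mem_union.1 hk with hkJ | hf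
    · exact hJL hkJ
    · obtain ⟨hkKJ, hpk⟩ := Finset.mem_filter.1 hf
      by_contra hkL
      exact hn k (Finset.mem_sdiff.2 ⟨(Finset.mem_sdiff.1 hkKJ).1, hkL⟩) hpk
  · intro hS k hk hpk
    obtain ⟨hkK, hkL⟩ := Finset.mem_sdiff.1 hk
    exact hkL (hS (Finset.mem_union_right _ (Finset.mem_filter.2
      ⟨Finset.mem_sdiff.2 ⟨hkK, fun hkJ => hkL (hJL hkJ)⟩, hpk⟩)))

/-- `J ⊆ S(H) ⊆ K`. [folklore] -/
theorem subset_posRootSet_subset {J K : Finset ι} (hJK : J ⊆ K) (H : V) :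
    J ⊆ posRootSet α ϖ J K H ∧ posRootSet α ϖ J K H ⊆ K :=
  ⟨Finset.subset_union_left,
    Finset.union_subset hJK fun _ hk => (Finset.mem_sdiff.1 (Finset.mem_filter.1 hk).1).1⟩

/-- `J ⊆ T(Y) ⊆ K`. [folklore] -/
theorem subset_nonposWeightSet_subset {J K : Finset ι} (hJK : J ⊆ K) (Y : V) :
    J ⊆ nonposWeightSet ϖ J K Y ∧ nonposWeightSet ϖ J K Y ⊆ K :=
  ⟨Finset.subset_union_left,
    Finset.union_subset hJK fun _ hk => (Finset.mem_sdiff.1 (Finset.mem_filter.1 hk).1).1⟩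

/-- `τ_P^Q(H) = 1 ⟺ Δ_0^Q ⊆ S(H)` (`S(H)` is the largest `Q` with `τ_P^Q(H) = 1`).
[cite: LabesseWaldspurger2013, Ch. 1, Prop. 1.7.2 (proof)] -/
theorem tau_iff_subset_posRootSet {J L K : Finset ι} (hLK : L ⊆ K) (H : V) :
    tau α ϖ J L H ↔ L ⊆ posRootSet α ϖ J K H :=
  forall_sdiff_iff_subset _ hLK

/-- `α(H) ≤ 0` on `Δ_P^R ∖ Δ_P^Q ⟺ S(H) ⊆ Δ_0^Q`. [folklore] -/
theorem forall_inner_root_nonpos_iff_posRootSet_subset {J L K : Finset ι} (hJL : J ⊆ L) (H : V) :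
    (∀ k ∈ K \ L, ⟪α k, H - proj α ϖ J H⟫ ≤ 0) ↔ posRootSet α ϖ J K H ⊆ L := by
  rw [posRootSet, ← forall_sdiff_not_iff_subset _ hJL]
  simp only [not_lt]

/-- `τ̂_Q^R(Y) = 1 ⟺ T(Y) ⊆ Δ_0^Q` (`T(Y)` is the smallest `Q` with `τ̂_Q^R(Y) = 1`).
[cite: LabesseWaldspurger2013, Ch. 1, Prop. 1.7.2 (proof)] -/
theorem hatTau_iff_nonposWeightSet_subset {J L K : Finset ι} (hJL : J ⊆ L) (Y : V) :
    hatTau ϖ L K Y ↔ nonposWeightSet ϖ J K Y ⊆ L := by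
  rw [nonposWeightSet, ← forall_sdiff_not_iff_subset _ hJL]
  simp only [not_le]
  rfl

/-- `ϖ(Y) ≤ 0` on `Δ̂_P^R ∖ Δ̂_Q^R ⟺ Δ_0^Q ⊆ T(Y)`. [folklore] -/
theorem forall_inner_dual_nonpos_iff_subset_nonposWeightSet {J L K : Finset ι} (hLK : L ⊆ K)
    (Y : V) : (∀ k ∈ L \ J, ⟪ϖ K k, Y⟫ ≤ 0) ↔ L ⊆ nonposWeightSet ϖ J K Y :=
  forall_sdiff_iff_subset _ hLK

/-- Membership in `C(P, Q, R, X)` pins `Q` down: `H ∈ C(P, Q, R, X) ⟺ Δ_0^Q = S(H) = T(H - X)`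
(for `P ⊂ Q ⊂ R`). [cite: LabesseWaldspurger2013, Ch. 1, Lemme 1.8.3 (proof)] -/
theorem mem_coneSet_iff {J L K : Finset ι} (hJL : J ⊆ L) (hLK : L ⊆ K) (X H : V) :
    H ∈ coneSet α ϖ J L K X ↔
      L = posRootSet α ϖ J K H ∧ L = nonposWeightSet ϖ J K (H - X) := by
  rw [mem_coneSet, show (∀ k ∈ L \ J, 0 < ⟪α k, H - proj α ϖ J H⟫) ↔ L ⊆ posRootSet α ϖ J K H
      from tau_iff_subset_posRootSet hLK H,
    forall_inner_root_nonpos_iff_posRootSet_subset hJL,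
    show (∀ k ∈ K \ L, 0 < ⟪ϖ K k, H - X⟫) ↔ nonposWeightSet ϖ J K (H - X) ⊆ L
      from hatTau_iff_nonposWeightSet_subset hJL (H - X),
    forall_inner_dual_nonpos_iff_subset_nonposWeightSet hLK]
  constructor
  · rintro ⟨h₁, h₂, h₃, h₄⟩
    exact ⟨Finset.Subset.antisymm h₁ h₂, Finset.Subset.antisymm h₄ h₃⟩
  · rintro ⟨h₁, h₂⟩
    exact ⟨h₁.le, h₁.ge, h₂.ge, h₂.le⟩

/-- For fixed `P`, `R`, `X` the sets `C(P, Q, R, X)` (`Q` varying) are pairwise disjoint.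
[cite: LabesseWaldspurger2013, Ch. 1, §1.8 (remark before Lemme 1.8.1)] -/
theorem disjoint_coneSet {J L L' K : Finset ι} (hJL : J ⊆ L) (hLK : L ⊆ K) (hJL' : J ⊆ L')
    (hL'K : L' ⊆ K) (hne : L ≠ L') (X : V) :
    Disjoint (coneSet α ϖ J L K X) (coneSet α ϖ J L' K X) := by
  refine Set.disjoint_left.2 fun H hH hH' => hne ?_
  rw [((mem_coneSet_iff hJL hLK X H).1 hH).1, ((mem_coneSet_iff hJL' hL'K X H).1 hH').1]

/-- Closed form of `Γ_P^R(H, X)`: with `S = S(H)` and `T = T(H - X)` the defining sum is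
`∑_{T ⊆ L ⊆ S} (-1)^{|K ∖ L|}`, which is `(-1)^{|K ∖ S|}` if `S = T` and `0` otherwise.
[cite: LabesseWaldspurger2013, Ch. 1, Lemme 1.8.3 (proof)] -/
theorem gammaInd_eq_ite {J K : Finset ι} (hJK : J ⊆ K) (H X : V) :
    gammaInd α ϖ J K H X =
      if posRootSet α ϖ J K H = nonposWeightSet ϖ J K (H - X)
        then (-1 : ℝ) ^ (K \ posRootSet α ϖ J K H).card else 0 := by
  set S₀ := posRootSet α ϖ J K H with hS₀
  set T₀ := nonposWeightSet ϖ J K (H - X) with hT₀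
  obtain ⟨hJS, hSK⟩ := subset_posRootSet_subset (α := α) (ϖ := ϖ) hJK H
  obtain ⟨hJT, hTK⟩ := subset_nonposWeightSet_subset (ϖ := ϖ) hJK (H - X)
  rw [← hS₀] at hJS hSK
  rw [← hT₀] at hJT hTK
  -- the sum is `∑_{T₀ ⊆ L ⊆ S₀} (-1)^{|K ∖ L|}`
  have hsum : gammaInd α ϖ J K H X = ∑ L ∈ Finset.Icc T₀ S₀, (-1 : ℝ) ^ (K \ L).card := by
    have hfil : Finset.Icc T₀ S₀ = (Finset.Icc J K).filter fun L => T₀ ⊆ L ∧ L ⊆ S₀ := by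
      ext L
      simp only [Finset.mem_filter, Finset.mem_Icc]
      exact ⟨fun ⟨h₁, h₂⟩ => ⟨⟨hJT.trans h₁, h₂.trans hSK⟩, h₁, h₂⟩, fun h => h.2⟩
    rw [gammaInd, hfil, Finset.sum_filter]
    refine Finset.sum_congr rfl fun L hL => ?_
    obtain ⟨hJL, hLK⟩ := Finset.mem_Icc.1 hL
    by_cases h₁ : tau α ϖ J L H
    · by_cases h₂ : hatTau ϖ L K (H - X)
      · rw [(tauInd_eq_one_iff α ϖ J L H).2 h₁, (hatTauInd_eq_one_iff ϖ L K (H - X)).2 h₂,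
          if_pos ⟨(hatTau_iff_nonposWeightSet_subset hJL (H - X)).1 h₂,
            (tau_iff_subset_posRootSet hLK H).1 h₁⟩, mul_one, mul_one]
      · rw [(hatTauInd_eq_zero_iff ϖ L K (H - X)).2 h₂, mul_zero, if_neg]
        exact fun hc => h₂ ((hatTau_iff_nonposWeightSet_subset hJL (H - X)).2 hc.1)
    · rw [(tauInd_eq_zero_iff α ϖ J L H).2 h₁, mul_zero, zero_mul, if_neg]
      exact fun hc => h₁ ((tau_iff_subset_posRootSet hLK H).2 hc.2)
  rw [hsum]
  by_cases hsub : T₀ ⊆ S₀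
  · calc ∑ L ∈ Finset.Icc T₀ S₀, (-1 : ℝ) ^ (K \ L).card
        = ∑ L ∈ Finset.Icc T₀ S₀, (-1 : ℝ) ^ K.card * (-1 : ℝ) ^ L.card := by
          refine Finset.sum_congr rfl fun L hL => ?_
          rw [neg_one_pow_card_sdiff ((Finset.mem_Icc.1 hL).2.trans hSK)]
      _ = (-1 : ℝ) ^ K.card * (if T₀ = S₀ then (-1 : ℝ) ^ T₀.card else 0) := by
          rw [← Finset.mul_sum, sum_Icc_neg_one_pow_card hsub]
      _ = if S₀ = T₀ then (-1 : ℝ) ^ (K \ S₀).card else 0 := by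
          by_cases heq : T₀ = S₀
          · rw [if_pos heq, if_pos heq.symm, heq, neg_one_pow_card_sdiff hSK]
          · rw [if_neg heq, if_neg (Ne.symm heq), mul_zero]
  · have hne : S₀ ≠ T₀ := fun e => hsub e.ge
    rw [Finset.Icc_eq_empty (fun hle => hsub hle), Finset.sum_empty, if_neg hne]

open scoped Classical in
/-- **Labesse–Waldspurger, Lemme 1.8.3** (first assertion): `H ↦ Γ_P^R(H, X)` is the combination
with coefficients `(-1)^{a_Q - a_R}` of the characteristic functions of the sets `C(P, Q, R, X)`:
`Γ_P^R(H, X) = ∑_{P ⊂ Q ⊂ R} (-1)^{a_Q - a_R} 𝟙_{C(P,Q,R,X)}(H)`.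
[cite: LabesseWaldspurger2013, Ch. 1, Lemme 1.8.3] -/
theorem gammaInd_eq_sum_indicator {J K : Finset ι} (hJK : J ⊆ K) (H X : V) :
    gammaInd α ϖ J K H X
      = ∑ L ∈ Finset.Icc J K,
          (-1 : ℝ) ^ (K \ L).card * (if H ∈ coneSet α ϖ J L K X then 1 else 0) := by
  rw [gammaInd_eq_ite hJK]
  set S₀ := posRootSet α ϖ J K H with hS₀
  set T₀ := nonposWeightSet ϖ J K (H - X) with hT₀
  obtain ⟨hJS, hSK⟩ := subset_posRootSet_subset (α := α) (ϖ := ϖ) hJK H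
  rw [← hS₀] at hJS hSK
  have hterm : ∀ L ∈ Finset.Icc J K,
      (-1 : ℝ) ^ (K \ L).card * (if H ∈ coneSet α ϖ J L K X then 1 else 0)
        = if L = S₀ then (if S₀ = T₀ then (-1 : ℝ) ^ (K \ S₀).card else 0) else 0 := by
    intro L hL
    obtain ⟨hJL, hLK⟩ := Finset.mem_Icc.1 hL
    have hiff := mem_coneSet_iff (α := α) (ϖ := ϖ) hJL hLK X H
    rw [← hS₀, ← hT₀] at hiff
    by_cases hLS : L = S₀
    · subst hLS
      by_cases hST : posRootSet α ϖ J K H = T₀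
      · rw [if_pos (hiff.2 ⟨rfl, hST⟩), if_pos rfl, if_pos hST, mul_one]
      · rw [if_neg (fun hm => hST (hiff.1 hm).2), if_pos rfl, if_neg hST, mul_zero]
    · rw [if_neg (fun hm => hLS (hiff.1 hm).1), if_neg hLS, mul_zero]
  rw [Finset.sum_congr rfl hterm, Finset.sum_ite_eq', if_pos (Finset.mem_Icc.2 ⟨hJS, hSK⟩)]

/-- `Γ_P^R(H, X) = (-1)^{a_Q - a_R}` for `H ∈ C(P, Q, R, X)`.
[cite: LabesseWaldspurger2013, Ch. 1, Lemme 1.8.3] -/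
theorem gammaInd_eq_of_mem_coneSet {J L K : Finset ι} (hJL : J ⊆ L) (hLK : L ⊆ K) {X H : V}
    (hH : H ∈ coneSet α ϖ J L K X) : gammaInd α ϖ J K H X = (-1 : ℝ) ^ (K \ L).card := by
  obtain ⟨h₁, h₂⟩ := (mem_coneSet_iff hJL hLK X H).1 hH
  rw [gammaInd_eq_ite (hJL.trans hLK), ← h₁, ← h₂, if_pos rfl]

/-- Off the union of the `C(P, Q, R, X)`, `Γ_P^R(·, X)` vanishes; equivalently, if
`Γ_P^R(H, X) ≠ 0` then `H ∈ C(P, Q, R, X)` for `Q` given by `Δ_0^Q = S(H)`.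
[cite: LabesseWaldspurger2013, Ch. 1, Lemme 1.8.3 (proof)] -/
theorem mem_coneSet_of_gammaInd_ne_zero {J K : Finset ι} (hJK : J ⊆ K) {H X : V}
    (hne : gammaInd α ϖ J K H X ≠ 0) :
    J ⊆ posRootSet α ϖ J K H ∧ posRootSet α ϖ J K H ⊆ K ∧
      H ∈ coneSet α ϖ J (posRootSet α ϖ J K H) K X := by
  obtain ⟨hJS, hSK⟩ := subset_posRootSet_subset (α := α) (ϖ := ϖ) hJK H
  refine ⟨hJS, hSK, (mem_coneSet_iff hJS hSK X H).2 ⟨rfl, ?_⟩⟩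
  by_contra hST
  rw [gammaInd_eq_ite hJK, if_neg hST] at hne
  exact hne rfl

/-- **Labesse–Waldspurger, Lemme 1.8.3** (second assertion; Arthur, Ann. of Math. 114 (1981),
Lemma 2.1; Shokranian, Lemma 5.4): the support of `H ↦ Γ_P^R(H, X)` has compact projection to
`𝔞_P^R`; precisely ("il existe `c > 0` tel que l'on ait `‖H_P^R‖ ≤ c ‖X_P^R‖` lorsque `H`
appartient à ce support"), with `c = 1`: `Γ_P^R(H, X) ≠ 0 ⟹ ‖H_P^R‖ ≤ ‖X_P^R‖`.
[cite: LabesseWaldspurger2013, Ch. 1, Lemme 1.8.3]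
[cite: Arthur1981TraceFormulaInvariantForm, §2, Lemma 2.1] [cite: Shokranian1992, Lemma 5.4] -/
theorem IsDualSystem.norm_relProj_le_of_gammaInd_ne_zero (h : IsDualSystem α ϖ) {J K : Finset ι}
    (hJK : J ⊆ K) {H X : V} (hne : gammaInd α ϖ J K H X ≠ 0) :
    ‖relProj α ϖ J K H‖ ≤ ‖relProj α ϖ J K X‖ := by
  obtain ⟨hJS, hSK, hmem⟩ := mem_coneSet_of_gammaInd_ne_zero hJK hne
  exact h.norm_relProj_le_of_mem_coneSet hJS hSK hmem

/-- The ball version of Lemme 1.8.3: on the support of `Γ_P^R(·, X)`, `H_P^R` lies in the closed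
ball with diameter `[0, X_P^R]`. [cite: LabesseWaldspurger2013, Ch. 1, Lemme 1.8.3] -/
theorem IsDualSystem.norm_relProj_sub_half_le_of_gammaInd_ne_zero (h : IsDualSystem α ϖ)
    {J K : Finset ι} (hJK : J ⊆ K) {H X : V} (hne : gammaInd α ϖ J K H X ≠ 0) :
    ‖relProj α ϖ J K H - (1 / 2 : ℝ) • relProj α ϖ J K X‖ ≤ 1 / 2 * ‖relProj α ϖ J K X‖ := by
  obtain ⟨hJS, hSK, hmem⟩ := mem_coneSet_of_gammaInd_ne_zero hJK hne
  exact h.norm_relProj_sub_half_le_of_mem_coneSet hJS hSK hmem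

open scoped Classical in
/-- **Labesse–Waldspurger, Lemme 1.8.3** (last assertion), for `X` in the closed positive chamber
(`⟪α k, X⟫ ≥ 0` on `K`; Labesse–Waldspurger: `X` regular): `Γ_P^R(·, X)` is the characteristic
function of `C(P, R, R, X) = {H : α(H) > 0 and ϖ_α(H - X) ≤ 0 for all α ∈ Δ_P^R}`.
[cite: LabesseWaldspurger2013, Ch. 1, Lemme 1.8.3] -/
theorem IsDualSystem.gammaInd_eq_indicator (h : IsDualSystem α ϖ) (hobt : IsObtuse α)
    {J K : Finset ι} (hli : LinIndepOn α K) (hJK : J ⊆ K) {X : V} (hX : ∀ k ∈ K, 0 ≤ ⟪α k, X⟫)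
    (H : V) : gammaInd α ϖ J K H X = if H ∈ coneSet α ϖ J K K X then 1 else 0 := by
  rw [gammaInd_eq_sum_indicator hJK, ← Finset.sum_erase_add _ _ (Finset.mem_Icc.2 ⟨hJK, le_rfl⟩),
    Finset.sdiff_self, Finset.card_empty, pow_zero, one_mul]
  have h0 : ∑ L ∈ (Finset.Icc J K).erase K,
      (-1 : ℝ) ^ (K \ L).card * (if H ∈ coneSet α ϖ J L K X then 1 else 0) = 0 := by
    refine Finset.sum_eq_zero fun L hL => ?_
    obtain ⟨hLK', hL'⟩ := Finset.mem_erase.1 hL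
    obtain ⟨hJL, hLK⟩ := Finset.mem_Icc.1 hL'
    rw [h.coneSet_eq_empty_of_inner_root_nonneg hobt hli hJL hLK hLK' hX]
    simp
  rw [h0, zero_add]

/-- **Labesse–Waldspurger, Lemme 1.8.3** (last assertion, as printed): for `X` in the closed
positive chamber, `Γ_P^R(H, X) = τ_P^R(H) φ_P^R(H - X)`.
[cite: LabesseWaldspurger2013, Ch. 1, Lemme 1.8.3] -/
theorem IsDualSystem.gammaInd_eq_tauInd_mul_phiInd (h : IsDualSystem α ϖ) (hobt : IsObtuse α)
    {J K : Finset ι} (hli : LinIndepOn α K) (hJK : J ⊆ K) {X : V} (hX : ∀ k ∈ K, 0 ≤ ⟪α k, X⟫)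
    (H : V) : gammaInd α ϖ J K H X = tauInd α ϖ J K H * phiInd ϖ J K K (H - X) := by
  rw [h.gammaInd_eq_indicator hobt hli hJK hX, phiInd_eq_ite ϖ hJK le_rfl, mem_coneSet, tauInd]
  have hvac : ∀ (p : ι → Prop), (∀ k ∈ K \ K, p k) ↔ True := fun p =>
    ⟨fun _ => trivial, fun _ k hk => by simp at hk⟩
  simp only [hvac, true_and, and_true]
  by_cases h₁ : tau α ϖ J K H
  · have h₁' : ∀ k ∈ K \ J, 0 < ⟪α k, H - proj α ϖ J H⟫ := h₁
    by_cases h₂ : ∀ k ∈ K \ J, ⟪ϖ K k, H - X⟫ ≤ 0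
    · rw [if_pos ⟨h₁', h₂⟩, if_pos h₁, if_pos h₂, mul_one]
    · rw [if_neg (fun hc => h₂ hc.2), if_neg h₂, mul_zero]
  · rw [if_neg (fun hc => h₁ hc.1), if_neg h₁, zero_mul]

/-- `Γ_P^R(H, 0) = δ_{P,R}` — Langlands' combinatorial lemma; equivalently (Lemme 1.8.1, last
assertion) all the `C(P, Q, R, 0)` are empty for `P ≠ R`.
[cite: LabesseWaldspurger2013, Ch. 1, §1.8 (remark before Lemme 1.8.6) and Prop. 1.7.2] -/
theorem IsDualSystem.gammaInd_zero (h : IsDualSystem α ϖ) (hobt : IsObtuse α) {J K : Finset ι}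
    (hli : LinIndepOn α K) (hJK : J ⊆ K) (H : V) :
    gammaInd α ϖ J K H 0 = if J = K then 1 else 0 := by
  rw [gammaInd]
  simp only [sub_zero]
  exact h.sum_Icc_neg_one_pow_mul_tauInd_mul_hatTauInd hobt hli hJK H

end Gamma

section GammaMatrix

variable [Fintype ι] {α : ι → V} {ϖ : Finset ι → ι → V}

/-- The entries of the matrix `Γ(H, X) = τ(H) τ̂(H - X)` of `LanglandsCombinatorialLemma.lean` are
the `Γ_P^R(H, X)` up to sign: `Γ_{P,R}(H, X) = (-1)^{a_P - a_R} Γ_P^R(H, X)` for `P ⊂ R` (with our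
sign convention, `(-1)^{|Δ_0^P| + |Δ_0^R|}`), and `0` otherwise.
[cite: LabesseWaldspurger2013, Ch. 1, §1.8 (definition of `Γ_P^Q`)] -/
theorem gammaMatrix_apply (α : ι → V) (ϖ : Finset ι → ι → V) (H X : V) (J K : Finset ι) :
    gammaMatrix α ϖ H X J K
      = if J ⊆ K then (-1 : ℝ) ^ J.card * (-1 : ℝ) ^ K.card * gammaInd α ϖ J K H X else 0 := by
  rw [gammaMatrix, Matrix.mul_apply]
  have hterm : ∀ L, tauMatrix α ϖ H J L * hatTauMatrix ϖ (H - X) L K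
      = if L ∈ Finset.Icc J K then
          (-1 : ℝ) ^ J.card * (-1 : ℝ) ^ L.card * (tauInd α ϖ J L H * hatTauInd ϖ L K (H - X))
        else 0 := by
    intro L
    simp only [tauMatrix, hatTauMatrix, Matrix.of_apply, Finset.mem_Icc]
    by_cases h₁ : J ⊆ L <;> by_cases h₂ : L ⊆ K <;> simp [h₁, h₂]
    ring
  rw [Finset.sum_congr rfl fun L _ => hterm L, ← Finset.sum_filter]
  have hfil : (Finset.univ.filter fun L => L ∈ Finset.Icc J K) = Finset.Icc J K := by
    ext L; simp
  rw [hfil]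
  by_cases hJK : J ⊆ K
  · rw [if_pos hJK, gammaInd, Finset.mul_sum]
    refine Finset.sum_congr rfl fun L hL => ?_
    rw [neg_one_pow_card_sdiff (Finset.mem_Icc.1 hL).2]
    have hKK : ((-1 : ℝ) ^ K.card) * ((-1 : ℝ) ^ K.card) = 1 := by
      rw [← pow_add, ← two_mul, pow_mul]; norm_num
    linear_combination
      (-((-1 : ℝ) ^ J.card * (-1 : ℝ) ^ L.card
        * (tauInd α ϖ J L H * hatTauInd ϖ L K (H - X)))) * hKK
  · rw [if_neg hJK, Finset.Icc_eq_empty (fun hle => hJK hle), Finset.sum_empty]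

end GammaMatrix

end ObtuseBasis

end Literature.NumberTheory.Automorphic

end
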